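import Mathlib
import Summits.Schanuel.Schanuel.Theses.RigidCore
import Summits.Schanuel.Schanuel.Theorems.RigidCoreMinimalCounterexampleInAclLogSector
import Summits.Schanuel.Schanuel.Theorems.MinimalCounterexampleInAcl.Negative.MateTrdeg

/-!
# KERNEL-TRANSLATION RIGIDITY — crux stmt-Schanuel-0969 `RigidCore.MinimalCounterexampleInAcl`

Line `kernel-arithmetic-selection`, registered stub `stub_kernelTranslateRigid` (`--supports stmt-Schanuel-0969`).

Let `x ∈ ℂⁿ` be a first failure of Schanuel's conjecture at rank `n` (`firstFailures n`: `x` ℚ-linearly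
independent, `trdeg ℚ(x, eˣ) < n`, Schanuel in all ranks `< n`), `c ≠ 0` and `k ∈ ℤⁿ`.  If every ℚ-polynomial
relation of the point `(x, eˣ, c)` survives the translation `x ↦ x + c·k` (same exponentials, same `c`), then
`k = 0`.  Proof (pure algebra):

* ITERATE (`aeval_translateLine_eq_zero`): the substitution `Xᵢ ↦ Xᵢ + kᵢ·T` (fixing the `Y`- and `T`-variables) is a
  ℚ-algebra endomorphism turning relations into relations, so every relation vanishes at `x + m c k` for all
  `m : ℕ`; the one-variable polynomial `t ↦ p(x + t k, eˣ, c)` has infinitely many roots, hence every relation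
  vanishes on the whole LINE `x + ℂ k`.
* PIVOT (`transcendental_pivot_of_translateLine`): if `k i₀ ≠ 0`, the `k`-orthogonal integer combinations
  `u_j = k_{i₀} x_{σ j} − k_{σ j} x_{i₀}` (`σ = i₀.succAbove`) and the exponentials `eˣ` are invariant along the
  line, so an algebraic dependence of `x_{i₀}` over `ℚ(u, eˣ)` would be a relation vanishing on the line, i.e. a
  polynomial over `ℚ(u, eˣ)` vanishing identically: `x_{i₀}` is transcendental over `ℚ(u, eˣ)`.
* COUNT: in the algebraic matroid, `rk(u, eˣ) + 1 = rk(u, eˣ, x_{i₀}) ≤ rk(x, eˣ) = trdeg ℚ(x, eˣ) ≤ n − 1`, while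
  `u` is ℚ-linearly independent (`linearIndependent_pivotCombos`) with `e^{u} ⊆ ℚ(eˣ)`, so Schanuel at rank `n − 1`
  gives `rk(u, eˣ) ≥ rk(u, eᵘ) ≥ n − 1` — contradiction.
-/

noncomputable section

-- single-problem summit: the module path `Summits.Schanuel.Schanuel.…` repeats a component by design
set_option linter.dupNamespace false

open Complex Set

namespace Summit.Schanuel.Schanuel.Cruxes.MinimalCounterexampleInAcl.KernelArithmeticSelection

open Literature.NumberTheory.Transcendental (SchanuelRank)
open Literature.NumberTheory.Transcendental
open MvPolynomial

/-! ## Iterate: relations surviving one translate vanish on the whole line -/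

/-- **ITERATION ALONG THE LINE.** If every ℚ-relation of `(x, eˣ, c)` (`c ≠ 0`) survives the translation
`x ↦ x + c·k`, then every ℚ-relation of `(x, eˣ, c)` vanishes at `(x + t·k, eˣ, c)` for EVERY `t : ℂ`: the
substitution `Xᵢ ↦ Xᵢ + kᵢ T` maps relations to relations, so by induction the relation vanishes at all
`x + m c k` (`m : ℕ`), infinitely many roots of the one-variable polynomial `t ↦ p(x + t k, eˣ, c)`. [folklore] -/
theorem aeval_translateLine_eq_zero {n : ℕ} (x : Fin n → ℂ) (c : ℂ) (k : Fin n → ℤ) (hc : c ≠ 0)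
    (H : ∀ p : MvPolynomial ((Fin n ⊕ Fin n) ⊕ Unit) ℚ,
      MvPolynomial.aeval (Sum.elim (Sum.elim x (cexp ∘ x)) (fun _ : Unit => c)) p = 0 →
      MvPolynomial.aeval (Sum.elim (Sum.elim (fun i => x i + c * (k i : ℂ)) (cexp ∘ x)) (fun _ : Unit => c))
        p = 0)
    (p : MvPolynomial ((Fin n ⊕ Fin n) ⊕ Unit) ℚ)
    (hp : MvPolynomial.aeval (Sum.elim (Sum.elim x (cexp ∘ x)) (fun _ : Unit => c)) p = 0) (t : ℂ) :
    MvPolynomial.aeval (Sum.elim (Sum.elim (fun i => x i + t * (k i : ℂ)) (cexp ∘ x)) (fun _ : Unit => c))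
      p = 0 := by
  classical
  -- the points of the line
  set pt : ℂ → ((Fin n ⊕ Fin n) ⊕ Unit) → ℂ :=
    fun s => Sum.elim (Sum.elim (fun i => x i + s * (k i : ℂ)) (cexp ∘ x)) (fun _ : Unit => c) with hpt
  have hpt0 : pt 0 = Sum.elim (Sum.elim x (cexp ∘ x)) (fun _ : Unit => c) := by
    funext s; rcases s with ((i | i) | u) <;> simp [hpt]
  have hptc : pt c = Sum.elim (Sum.elim (fun i => x i + c * (k i : ℂ)) (cexp ∘ x)) (fun _ : Unit => c) := by
    funext s; rcases s with ((i | i) | u) <;> simp [hpt]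
  have hp0 : MvPolynomial.aeval (pt 0) p = 0 := by rw [hpt0]; exact hp
  -- the shift `Xᵢ ↦ Xᵢ + kᵢ T`
  set g : ((Fin n ⊕ Fin n) ⊕ Unit) → MvPolynomial ((Fin n ⊕ Fin n) ⊕ Unit) ℚ :=
    Sum.elim (Sum.elim (fun i => X (Sum.inl (Sum.inl i)) + C (k i : ℚ) * X (Sum.inr ()))
      (fun i => X (Sum.inl (Sum.inr i)))) (fun u => X (Sum.inr u)) with hg
  have hshift : ∀ (s : ℂ) (q : MvPolynomial ((Fin n ⊕ Fin n) ⊕ Unit) ℚ),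
      MvPolynomial.aeval (pt s) (bind₁ g q) = MvPolynomial.aeval (pt (s + c)) q := by
    intro s q
    have hgv : (fun v => MvPolynomial.aeval (pt s) (g v)) = pt (s + c) := by
      funext v
      rcases v with ((i | i) | u)
      · simp [hg, hpt]; ring
      · simp [hg, hpt]
      · simp [hg, hpt]
    rw [aeval_bind₁, hgv]
  -- iterate
  have hiter : ∀ N : ℕ, ∀ q : MvPolynomial ((Fin n ⊕ Fin n) ⊕ Unit) ℚ,
      MvPolynomial.aeval (pt 0) q = 0 → MvPolynomial.aeval (pt ((N : ℂ) * c)) q = 0 := by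
    intro N
    induction N with
    | zero => intro q hq; simpa using hq
    | succ N ih =>
      intro q hq
      have h1 : MvPolynomial.aeval (pt 0) (bind₁ g q) = 0 := by
        rw [hshift, zero_add, hptc]
        exact H q (by rw [← hpt0]; exact hq)
      have h2 := ih _ h1
      rw [hshift] at h2
      have hN : ((N + 1 : ℕ) : ℂ) * c = (N : ℂ) * c + c := by push_cast; ring
      rw [hN]
      exact h2
  -- the one-variable polynomial along the line
  set L : ((Fin n ⊕ Fin n) ⊕ Unit) → Polynomial ℂ :=
    Sum.elim (Sum.elim (fun i => Polynomial.C (x i) + Polynomial.C ((k i : ℂ)) * Polynomial.X)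
      (fun i => Polynomial.C (cexp (x i)))) (fun _ => Polynomial.C c) with hL
  have hQ : ∀ (s : ℂ) (q : MvPolynomial ((Fin n ⊕ Fin n) ⊕ Unit) ℚ),
      (MvPolynomial.aeval L q).eval s = MvPolynomial.aeval (pt s) q := by
    intro s q
    have hLv : ∀ v, (L v).eval s = pt s v := by
      intro v
      rcases v with ((i | i) | u)
      · simp [hL, hpt]; ring
      · simp [hL, hpt]
      · simp [hL, hpt]
    induction q using MvPolynomial.induction_on with
    | C a => simp
    | add p q hp hq => simp [hp, hq]
    | mul_X p v hp => rw [map_mul, map_mul, Polynomial.eval_mul, hp, MvPolynomial.aeval_X,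
        MvPolynomial.aeval_X, hLv]
  have hzero : MvPolynomial.aeval L p = 0 := by
    apply Polynomial.eq_zero_of_infinite_isRoot
    refine Set.infinite_of_injective_forall_mem (f := fun N : ℕ => (N : ℂ) * c) ?_ ?_
    · intro a b hab
      have hab' : (a : ℂ) * c = (b : ℂ) * c := hab
      exact_mod_cast mul_right_cancel₀ hc hab'
    · intro N
      show ((MvPolynomial.aeval L p).eval ((N : ℂ) * c)) = 0
      rw [hQ]
      exact hiter N p hp0
  have h := hQ t p
  rw [hzero, Polynomial.eval_zero] at h
  exact h.symm

/-! ## Pivot: the pivot coordinate is transcendental over the invariants of the line -/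

/-- **THE PIVOT IS TRANSCENDENTAL OVER THE LINE INVARIANTS.** If every ℚ-relation of `(x, eˣ, c)` vanishes on the
line `(x + t k, eˣ, c)` and `k i₀ ≠ 0`, then `x i₀` is transcendental over `ℚ[u, eˣ]`, `u_j = k_{i₀} x_{σ j} −
k_{σ j} x_{i₀}` (`σ = i₀.succAbove`): an algebraic dependence `Σ_d P_d(u, eˣ) W^d` of `x i₀` lifts (choosing
ℚ-polynomial representatives of the coefficients) to a relation of `(x, eˣ, c)`, which vanishes on the line where
`u, eˣ` are constant and `W = x i₀ + t k i₀` sweeps `ℂ`; so the dependence vanishes identically. [folklore] -/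
theorem transcendental_pivot_of_translateLine {m : ℕ} (x : Fin (m + 1) → ℂ) (c : ℂ) (k : Fin (m + 1) → ℤ)
    (i₀ : Fin (m + 1)) (hi₀ : k i₀ ≠ 0)
    (hline : ∀ p : MvPolynomial ((Fin (m + 1) ⊕ Fin (m + 1)) ⊕ Unit) ℚ,
      MvPolynomial.aeval (Sum.elim (Sum.elim x (cexp ∘ x)) (fun _ : Unit => c)) p = 0 → ∀ t : ℂ,
      MvPolynomial.aeval (Sum.elim (Sum.elim (fun i => x i + t * (k i : ℂ)) (cexp ∘ x)) (fun _ : Unit => c))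
        p = 0) :
    Transcendental (Algebra.adjoin ℚ (Set.range (fun j : Fin m =>
        (k i₀ : ℂ) * x (i₀.succAbove j) - (k (i₀.succAbove j) : ℂ) * x i₀) ∪ Set.range (cexp ∘ x))) (x i₀) := by
  classical
  set u : Fin m → ℂ := fun j => (k i₀ : ℂ) * x (i₀.succAbove j) - (k (i₀.succAbove j) : ℂ) * x i₀ with hu
  set uv : Fin m ⊕ Fin (m + 1) → ℂ := Sum.elim u (cexp ∘ x) with huv
  have hU : Set.range u ∪ Set.range (cexp ∘ x) = Set.range uv := (Set.Sum.elim_range u (cexp ∘ x)).symm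
  rintro ⟨q, hq0, hqw⟩
  -- ℚ-polynomial representatives of the coefficients
  have hcoef : ∀ d : ℕ, ∃ P : MvPolynomial (Fin m ⊕ Fin (m + 1)) ℚ,
      MvPolynomial.aeval uv P = ((q.coeff d) : ℂ) := by
    intro d
    have hmem : ((q.coeff d) : ℂ) ∈ (MvPolynomial.aeval (R := ℚ) uv).range := by
      rw [← Algebra.adjoin_range_eq_range_aeval, ← hU]
      exact (q.coeff d).2
    exact (AlgHom.mem_range _).1 hmem
  choose P hP using hcoef
  -- the lift of the dependence to a relation of `(x, eˣ, c)`
  set emb : Fin m ⊕ Fin (m + 1) → MvPolynomial ((Fin (m + 1) ⊕ Fin (m + 1)) ⊕ Unit) ℚ :=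
    Sum.elim (fun j => C (k i₀ : ℚ) * X (Sum.inl (Sum.inl (i₀.succAbove j))) -
      C (k (i₀.succAbove j) : ℚ) * X (Sum.inl (Sum.inl i₀))) (fun i => X (Sum.inl (Sum.inr i))) with hemb
  set f : MvPolynomial ((Fin (m + 1) ⊕ Fin (m + 1)) ⊕ Unit) ℚ :=
    ∑ d ∈ q.support, bind₁ emb (P d) * X (Sum.inl (Sum.inl i₀)) ^ d with hf
  -- its value at a point with prescribed invariants
  have hfeval : ∀ v : ((Fin (m + 1) ⊕ Fin (m + 1)) ⊕ Unit) → ℂ, (∀ i, v (Sum.inl (Sum.inr i)) = cexp (x i)) →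
      (∀ j, (k i₀ : ℂ) * v (Sum.inl (Sum.inl (i₀.succAbove j))) -
        (k (i₀.succAbove j) : ℂ) * v (Sum.inl (Sum.inl i₀)) = u j) →
      MvPolynomial.aeval v f = ∑ d ∈ q.support, ((q.coeff d) : ℂ) * v (Sum.inl (Sum.inl i₀)) ^ d := by
    intro v hv1 hv2
    have hembv : (fun s => MvPolynomial.aeval v (emb s)) = uv := by
      funext s
      rcases s with (j | i)
      · simpa [hemb, huv] using hv2 j
      · simp [hemb, huv, hv1]
    have hPd : ∀ d, MvPolynomial.aeval v (bind₁ emb (P d)) = ((q.coeff d) : ℂ) := by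
      intro d
      rw [aeval_bind₁, hembv, hP]
    simp only [hf, map_sum, map_mul, map_pow, MvPolynomial.aeval_X, hPd]
  -- the map of `q` to `ℂ[W]`
  have hQ : ∀ z : ℂ, (q.map (algebraMap _ ℂ)).eval z = ∑ d ∈ q.support, ((q.coeff d) : ℂ) * z ^ d := by
    intro z
    rw [Polynomial.eval_map, Polynomial.eval₂_eq_sum, Polynomial.sum_def]
    rfl
  -- `f` is a relation
  have hf0 : MvPolynomial.aeval (Sum.elim (Sum.elim x (cexp ∘ x)) (fun _ : Unit => c)) f = 0 := by
    rw [hfeval _ (fun i => rfl) (fun j => by simp [hu])]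
    simp only [Sum.elim_inl]
    rw [← hQ, Polynomial.eval_map, ← Polynomial.aeval_def]
    exact hqw
  -- so `q` vanishes on all of `ℂ`
  have hk0 : (k i₀ : ℂ) ≠ 0 := Int.cast_ne_zero.2 hi₀
  have hroots : ∀ z : ℂ, (q.map (algebraMap _ ℂ)).eval z = 0 := by
    intro z
    have h := hline f hf0 ((z - x i₀) / (k i₀ : ℂ))
    rw [hfeval _ (fun i => rfl) (fun j => by simp only [Sum.elim_inl, hu]; ring)] at h
    simp only [Sum.elim_inl] at h
    have hz : x i₀ + (z - x i₀) / (k i₀ : ℂ) * (k i₀ : ℂ) = z := by field_simp; ring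
    rw [hz] at h
    rw [hQ]
    exact h
  have hmap : q.map (algebraMap _ ℂ) = 0 :=
    Polynomial.funext fun z => by rw [hroots z, Polynomial.eval_zero]
  have hinj : Function.Injective (algebraMap (Algebra.adjoin ℚ (Set.range u ∪ Set.range (cexp ∘ x))) ℂ) :=
    fun a b h => Subtype.ext h
  exact hq0 ((Polynomial.map_eq_zero_iff hinj).1 hmap)

/-! ## The pivot combinations are linearly independent -/

/-- The `k`-orthogonal integer combinations `u_j = k_{i₀} x_{σ j} − k_{σ j} x_{i₀}` (`σ = i₀.succAbove`,
`k i₀ ≠ 0`) of a ℚ-linearly independent tuple are ℚ-linearly independent. [folklore] -/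
theorem linearIndependent_pivotCombos {m : ℕ} {x : Fin (m + 1) → ℂ} (hx : LinearIndependent ℚ x)
    (k : Fin (m + 1) → ℤ) (i₀ : Fin (m + 1)) (hi₀ : k i₀ ≠ 0) :
    LinearIndependent ℚ (fun j : Fin m =>
      (k i₀ : ℂ) * x (i₀.succAbove j) - (k (i₀.succAbove j) : ℂ) * x i₀) := by
  rw [Fintype.linearIndependent_iff] at hx ⊢
  intro q hq j
  -- the coefficient vector of the induced relation among the `x i`
  let g : Fin (m + 1) → ℚ :=
    Fin.insertNth i₀ (-(∑ j, q j * (k (i₀.succAbove j) : ℚ))) (fun j => q j * (k i₀ : ℚ))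
  have hg : ∑ i, g i • x i = 0 := by
    rw [Fin.sum_univ_succAbove _ i₀]
    simp only [g, Fin.insertNth_apply_same, Fin.insertNth_apply_succAbove]
    rw [← hq]
    simp only [Rat.smul_def]
    push_cast
    rw [neg_mul, Finset.sum_mul, ← Finset.sum_neg_distrib, ← Finset.sum_add_distrib]
    refine Finset.sum_congr rfl fun j _ => ?_
    ring
  have h := hx g hg (i₀.succAbove j)
  simp only [g, Fin.insertNth_apply_succAbove, mul_eq_zero, Int.cast_eq_zero] at h
  exact h.resolve_right hi₀

/-! ## The registered stub -/

/-- **KERNEL-TRANSLATION RIGIDITY (registered stub `stub_kernelTranslateRigid`, PROVED).** At a first failure `x`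
of rank `n`, no non-zero integer direction `k` lets the ℚ-relation ideal of `(x, eˣ, c)` (`c ≠ 0`) survive the
translation `x ↦ x + c·k`: otherwise every relation vanishes on the line `x + ℂk` (`aeval_translateLine_eq_zero`),
the pivot `x_{i₀}` (`k i₀ ≠ 0`) is transcendental over `ℚ(u, eˣ)` for the `n − 1` line-invariant integer
combinations `u` (`transcendental_pivot_of_translateLine`), so `rk(u, eᵘ) ≤ rk(u, eˣ) ≤ trdeg ℚ(x, eˣ) − 1 ≤ n − 2`
in the algebraic matroid, contradicting Schanuel at rank `n − 1` for the ℚ-linearly independent `u`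
(`linearIndependent_pivotCombos`). -/
theorem stub_kernelTranslateRigid : ∀ (n : ℕ) (x : Fin n → ℂ) (c : ℂ) (k : Fin n → ℤ), x ∈ Summit.Schanuel.Schanuel.Cruxes.MinimalCounterexampleInAcl.KernelArithmeticSelection.firstFailures n → c ≠ 0 → (∀ p : MvPolynomial ((Fin n ⊕ Fin n) ⊕ Unit) ℚ, MvPolynomial.aeval (Sum.elim (Sum.elim x (Complex.exp ∘ x)) (fun _ : Unit => c)) p = 0 → MvPolynomial.aeval (Sum.elim (Sum.elim (fun i => x i + c * (k i : ℂ)) (Complex.exp ∘ x)) (fun _ : Unit => c)) p = 0) → k = 0 := by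
  intro n x c k hx hc H
  by_contra hk
  obtain ⟨i₀, hi₀⟩ : ∃ i, k i ≠ 0 := by
    by_contra h
    push Not at h
    exact hk (funext h)
  obtain ⟨m, rfl⟩ : ∃ m, n = m + 1 := ⟨n - 1, (Nat.succ_pred_eq_of_pos i₀.pos).symm⟩
  have hline := fun p hp t => aeval_translateLine_eq_zero x c k hc H p hp t
  have htrans := transcendental_pivot_of_translateLine x c k i₀ hi₀ hline
  have hu := linearIndependent_pivotCombos hx.1 k i₀ hi₀
  set u : Fin m → ℂ := fun j => (k i₀ : ℂ) * x (i₀.succAbove j) - (k (i₀.succAbove j) : ℂ) * x i₀ with hu_def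
  set U : Set ℂ := range u ∪ range (cexp ∘ x) with hU
  set S : Set ℂ := range x ∪ range (cexp ∘ x) with hS
  -- `x i₀, u, eˣ` lie in `ℚ(x, eˣ)`
  have hUS : insert (x i₀) U ⊆ (GammaField.algMatroid ℂ).closure S := by
    have h1 : insert (x i₀) U ⊆ (IntermediateField.adjoin ℚ S : Set ℂ) := by
      rw [Set.insert_subset_iff, hU, Set.union_subset_iff, Set.range_subset_iff, Set.range_subset_iff]
      refine ⟨IntermediateField.subset_adjoin ℚ S (Or.inl ⟨i₀, rfl⟩), fun j => ?_, fun i => ?_⟩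
      · exact sub_mem (mul_mem (intCast_mem _ _) (IntermediateField.subset_adjoin ℚ S (Or.inl ⟨_, rfl⟩)))
          (mul_mem (intCast_mem _ _) (IntermediateField.subset_adjoin ℚ S (Or.inl ⟨_, rfl⟩)))
      · exact IntermediateField.subset_adjoin ℚ S (Or.inr ⟨i, rfl⟩)
    exact h1.trans (GammaField.adjoin_subset_acl S)
  -- `x i₀ ∉ acl(u, eˣ)`
  have hwU : x i₀ ∉ (GammaField.algMatroid ℂ).closure U := fun h => htrans (GammaField.mem_acl_iff.1 h)
  -- `u, eᵘ ∈ acl(u, eˣ)`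
  have huU : range u ∪ range (cexp ∘ u) ⊆ (GammaField.algMatroid ℂ).closure U := by
    have h1 : range u ∪ range (cexp ∘ u) ⊆ (IntermediateField.adjoin ℚ U : Set ℂ) := by
      rw [Set.union_subset_iff, Set.range_subset_iff, Set.range_subset_iff]
      refine ⟨fun j => IntermediateField.subset_adjoin ℚ U (Or.inl ⟨j, rfl⟩), fun j => ?_⟩
      simp only [Function.comp_apply, hu_def]
      rw [Complex.exp_sub, Complex.exp_int_mul, Complex.exp_int_mul]
      exact div_mem (zpow_mem (IntermediateField.subset_adjoin ℚ U (Or.inr ⟨_, rfl⟩)) _)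
        (zpow_mem (IntermediateField.subset_adjoin ℚ U (Or.inr ⟨_, rfl⟩)) _)
    exact h1.trans (GammaField.adjoin_subset_acl U)
  -- rank count
  have hSR : SchanuelRank m := hx.2.2 m (Nat.lt_succ_self m)
  have h4 : (m : ℕ∞) ≤ (GammaField.algMatroid ℂ).eRk (range u ∪ range (cexp ∘ u)) :=
    ZilberHomogeneity.natCast_le_eRk_of_le_trdeg (hSR u hu)
  have h5 : (GammaField.algMatroid ℂ).eRk (range u ∪ range (cexp ∘ u)) ≤ (GammaField.algMatroid ℂ).eRk U := by
    rw [← (GammaField.algMatroid ℂ).eRk_closure_eq U]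
    exact (GammaField.algMatroid ℂ).eRk_mono huU
  have h1 : (GammaField.algMatroid ℂ).eRk (insert (x i₀) U) = (GammaField.algMatroid ℂ).eRk U + 1 :=
    (GammaField.algMatroid ℂ).eRk_insert_eq_add_one ⟨by simp, hwU⟩
  have h2 : (GammaField.algMatroid ℂ).eRk (insert (x i₀) U) ≤ (GammaField.algMatroid ℂ).eRk S := by
    rw [← (GammaField.algMatroid ℂ).eRk_closure_eq S]
    exact (GammaField.algMatroid ℂ).eRk_mono hUS
  have h3 : ¬ (((m + 1 : ℕ) : ℕ∞) ≤ (GammaField.algMatroid ℂ).eRk S) := fun h =>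
    (not_le.2 hx.2.1) (le_trdeg_adjoin_of_natCast_le_eRk h)
  refine h3 ?_
  calc ((m + 1 : ℕ) : ℕ∞) = (m : ℕ∞) + 1 := by push_cast; rfl
    _ ≤ (GammaField.algMatroid ℂ).eRk U + 1 := add_le_add (h4.trans h5) le_rfl
    _ = (GammaField.algMatroid ℂ).eRk (insert (x i₀) U) := h1.symm
    _ ≤ (GammaField.algMatroid ℂ).eRk S := h2

end Summit.Schanuel.Schanuel.Cruxes.MinimalCounterexampleInAcl.KernelArithmeticSelection

end
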